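import Mathlib
import HarnessLib
import Literature.Analysis.FluidPDE.SolenoidalTruncation
import Literature.Analysis.FluidPDE.MildSolutionProofs
import Summits.NavierStokesRegularity.NavierStokesRegularity.Theorems.PoloidalWindowDoorPoloidalWindowRigidityLargeScaleMomentum
import Summits.NavierStokesRegularity.NavierStokesRegularity.Theorems.PoloidalWindowDoorPoloidalWindowRigidityLargeScaleEnergy
import Summits.NavierStokesRegularity.NavierStokesRegularity.Theorems.PoloidalWindowDoorPoloidalWindowRigidityLargeScaleEnergyDecayTools

/-!
# K2 `PoloidalWindowRigidity` (stmt-NavierStokesRegularity-19708) — ZERO LARGE-SCALE MOMENTUM: two profiles of the Type-I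
# mild class whose slices at one time differ by a constant vector are equal there

Cell ns-regularity-ideate, seat nsreg-p7 gen 7 (third worker under the K2 lead ns-poloidal-K2-p1).  Whole-class,
(M)-consuming tool, the quantitative end of nsreg-p7 g6's LARGE-SCALE MOMENTUM CONSERVATION
(`…LargeScaleMomentum.abs_integral_mul_inner_sub_le`) combined with the Type-I decay in the FAR PAST; consumed by the
one-slice, any-axis form of stratum (A′) (`…OneSliceCurlAxisymmetric`).

* `integral_norm_le_of_le_of_support` — `L¹` size of a function dominated by a constant on `B̄(0,2R)` and zero outside.
* `exists_cutoff_momentum_defect_le` — for a profile of the class and `s' < s < 0`, `R ≥ 1`, any `e`: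
  `|∫ cutoff R · ⟪v(s) − v(s'), e⟫| ≤ ‖e‖ (s − s') K |B̄(0,2R)|/R` with ONE `K = K(C, s, cut-off constants)` (the cut-off's
  `L¹` sizes `∫|Δζ_R| ≲ |B̄_{2R}|/R²`, `∫‖Dζ_R‖ ≲ |B̄_{2R}|/R`, `∫‖D²ζ_R‖ ≲ |B̄_{2R}|/R²`, `∫ζ_R ≤ |B̄_{2R}|`).
* `volume_real_closedBall_le_integral_cutoff` — `∫ cutoff R ≥ |B̄(0,R)|`.
* `eq_zero_of_slice_sub_eq_const` — **if two profiles `v, w` of the class (same rate `C`) satisfy `w(s) − v(s) ≡ d` on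
  ONE slice, then `d = 0`**: `‖d‖²∫ζ_R` = (momentum defect of `w` on `[s',s]`) + `∫ζ_R⟪w(s') − v(s'), d⟫` + (momentum
  defect of `v`); the middle term is `≤ 2‖d‖(C/√(−s'))∫ζ_R`, the defects are `O(|B̄_{2R}|/R) = O(8|B̄_R|/R)`, and
  `∫ζ_R ≥ |B̄_R|`; choose `s'` far in the past, then `R` large.  Reading: the LARGE-SCALE MEAN VELOCITY of a profile of
  the class is zero on every slice (compare `w ≡` the trivial profile shifted — not in the class; the lemma is stated
  for pairs so that no limit object is needed).

WHAT THIS IS NOT: not a claim about Navier–Stokes regularity and not the crux — a whole-class tool (bears_on LADDER-NS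
N0, route PoloidalWindowDoor, crux K2; `--supports` the K2 item).
-/

noncomputable section

-- the summit and its single sub-problem share the name (CONVENTIONS §1), as in every Theorems file
set_option linter.dupNamespace false

namespace Summit.NavierStokesRegularity.NavierStokesRegularity.Theorems.PoloidalWindowDoorPoloidalWindowRigidityZeroMeanMomentum

open MeasureTheory Set Function Filter Topology Metric InnerProductSpace
open scoped RealInnerProductSpace Laplacian
open Literature.Analysis Literature.Analysis.FluidPDE Literature.Analysis.UnboundedOperators
open Summit.NavierStokesRegularity.NavierStokesRegularity.Theorems.LocalSineTubeDoorProfileAlignedWindowRigidityAncient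
open Summit.NavierStokesRegularity.NavierStokesRegularity.Theorems.PoloidalWindowDoorPoloidalWindowRigidityLargeScaleMomentum
open Summit.NavierStokesRegularity.NavierStokesRegularity.Theorems.PoloidalWindowDoorPoloidalWindowRigidityLargeScaleEnergy
open Summit.NavierStokesRegularity.NavierStokesRegularity.Theorems.PoloidalWindowDoorPoloidalWindowRigidityLargeScaleEnergyDecayTools

variable {C : ℝ} {v : ℝ → EuclideanSpace ℝ (Fin 3) → EuclideanSpace ℝ (Fin 3)}

/-! ### the `L¹` sizes of the cut-off and the momentum defect -/

/-- The `L¹` size of a function dominated by a constant on `B̄(0,2R)` and vanishing outside. -/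
theorem integral_norm_le_of_le_of_support {F : Type*} [NormedAddCommGroup F]
    {f : EuclideanSpace ℝ (Fin 3) → F} {R A : ℝ}
    (hle : ∀ x, ‖f x‖ ≤ A) (hzero : ∀ x, x ∉ closedBall (0 : EuclideanSpace ℝ (Fin 3)) (2 * R) → f x = 0) :
    ∫ x, ‖f x‖ ≤ A * volume.real (closedBall (0 : EuclideanSpace ℝ (Fin 3)) (2 * R)) := by
  set K : Set (EuclideanSpace ℝ (Fin 3)) := closedBall (0 : EuclideanSpace ℝ (Fin 3)) (2 * R) with hKdef
  have hsupp : ∀ x ∉ K, ‖f x‖ = 0 := fun x hx => by rw [hzero x hx, norm_zero]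
  rw [← setIntegral_eq_integral_of_forall_compl_eq_zero (s := K) (fun x hx => hsupp x hx)]
  have hKfin : volume K < ⊤ := measure_closedBall_lt_top
  have h := norm_setIntegral_le_of_norm_le_const hKfin (f := fun x => ‖f x‖) (C := A)
    (fun x _ => by rw [norm_norm]; exact hle x)
  rw [Real.norm_eq_abs, abs_of_nonneg (integral_nonneg fun _ => norm_nonneg _)] at h
  linarith

/-- **The momentum defect against the cut-off.**  For a profile of the route's Type-I class (rate `C`, continuity on
the slab, Oseen-mild), times `s' < s < 0` and `R > 0`: `|∫ cutoff R · ⟪v(s) − v(s'), e⟫| ≤ ‖e‖·(s − s')·K·|B̄(0,2R)|/R`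
with `K` depending only on `C`, `s` and the cut-off constants — LARGE-SCALE MOMENTUM CONSERVATION (tree
`abs_integral_mul_inner_sub_le`) with the cut-off's `L¹` sizes. -/
theorem exists_cutoff_momentum_defect_le (hrate : HasTypeITimeDecay C v)
    (hcont : ContinuousOn (uncurry v) (Iio (0 : ℝ) ×ˢ univ))
    (hmild : ∀ s t : ℝ, s < t → t < 0 → ∀ y,
      v t y = heatExtension (v s) (t - s) y - oseenDuhamel 1 s v v t y)
    {s : ℝ} (hs : s < 0) :
    ∃ K : ℝ, 0 ≤ K ∧ ∀ s' : ℝ, s' < s → ∀ R : ℝ, 1 ≤ R → ∀ e : EuclideanSpace ℝ (Fin 3),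
      |∫ x, cutoff (E := EuclideanSpace ℝ (Fin 3)) R x * ⟪v s x - v s' x, e⟫| ≤
        ‖e‖ * (s - s') * (K * volume.real (closedBall (0 : EuclideanSpace ℝ (Fin 3)) (2 * R)) / R) := by
  obtain ⟨C₁, hC₁0, hC₁⟩ := exists_norm_fderiv_cutoff_le (E := EuclideanSpace ℝ (Fin 3))
  obtain ⟨C₂, hC₂0, hC₂⟩ := exists_abs_laplacian_cutoff_le (E := EuclideanSpace ℝ (Fin 3))
  obtain ⟨C₃, hC₃0, hC₃⟩ := exists_norm_fderiv_fderiv_cutoff_le (E := EuclideanSpace ℝ (Fin 3))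
  -- the bound `M = C/√(−s)` on the whole past of `s`
  set M : ℝ := C / Real.sqrt (-s) with hM
  have hM0 : 0 ≤ M := (norm_nonneg _).trans (hrate s hs 0)
  have hC0 : 0 ≤ C := by
    by_contra hC
    push Not at hC
    have h1 := div_neg_of_neg_of_pos hC (Real.sqrt_pos.2 (neg_pos.2 hs))
    linarith [(norm_nonneg (v s 0)).trans (hrate s hs 0)]
  have hMall : ∀ τ ≤ s, ∀ y, ‖v τ y‖ ≤ M := by
    intro τ hτ y
    have hτ0 : τ < 0 := lt_of_le_of_lt hτ hs
    refine (hrate τ hτ0 y).trans ?_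
    exact div_le_div_of_nonneg_left hC0 (Real.sqrt_pos.2 (neg_pos.2 hs)) (Real.sqrt_le_sqrt (by linarith))
  -- the dimensional constants of the momentum lemma
  set κ : ℝ := (2 : ℝ) ^ ((Module.finrank ℝ (EuclideanSpace ℝ (Fin 3)) : ℝ) / 2) with hκ
  have hκ0 : 0 ≤ κ := by positivity
  refine ⟨M * C₂ + M ^ 2 * (C₁ + κ * 2 * C₃ + (3 / 2 * κ + 8 * 64 * κ ^ 3) * 2), by positivity,
    fun s' hs' R hR e => ?_⟩
  have hR0 : 0 < R := by linarith
  have hs'0 : s' < 0 := hs'.trans hs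
  set V2 : ℝ := volume.real (closedBall (0 : EuclideanSpace ℝ (Fin 3)) (2 * R)) with hV2
  have hV20 : 0 ≤ V2 := measureReal_nonneg
  -- hypotheses of the momentum lemma on the window `(s', s)`
  have hsub : Ioo s' s ×ˢ (univ : Set (EuclideanSpace ℝ (Fin 3))) ⊆ Iio 0 ×ˢ univ :=
    prod_mono (fun τ hτ => lt_trans hτ.2 hs) subset_rfl
  have hmeas : AEStronglyMeasurable (uncurry v) (volume.restrict (Ioo s' s ×ˢ univ)) :=
    (hcont.mono hsub).aestronglyMeasurable (measurableSet_Ioo.prod MeasurableSet.univ)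
  have hθ := isTestFunctionOn_cutoff (R := R) hR0
  have h := abs_integral_mul_inner_sub_le hs' hM0 hR0 hmeas (fun τ hτ y => hMall τ hτ.2.le y)
    (continuous_slice hcont hs'0) (continuous_slice hcont hs) (fun y => hMall s' hs'.le y) (fun y => hMall s le_rfl y)
    (hmild s' s hs' hs) hθ e
  -- the four `L¹` sizes
  set ζ : EuclideanSpace ℝ (Fin 3) → ℝ := cutoff (E := EuclideanSpace ℝ (Fin 3)) R with hζ
  have hsuppζ : tsupport ζ ⊆ closedBall 0 (2 * R) := FluidPDE.tsupport_cutoff_subset hR0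
  have hout : ∀ x, x ∉ closedBall (0 : EuclideanSpace ℝ (Fin 3)) (2 * R) → x ∉ tsupport ζ := fun x hx h' => hx (hsuppζ h')
  have hI0 : ∫ x, |ζ x| ≤ 1 * V2 := by
    have := integral_norm_le_of_le_of_support (f := ζ) (R := R) (A := 1)
      (fun x => by rw [Real.norm_eq_abs, abs_of_nonneg (cutoff_nonneg R x)]; exact cutoff_le_one R x)
      (fun x hx => image_eq_zero_of_notMem_tsupport (hout x hx))
    simpa [Real.norm_eq_abs] using this
  have hI1 : ∫ x, ‖fderiv ℝ ζ x‖ ≤ C₁ / R * V2 := by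
    refine integral_norm_le_of_le_of_support (F := EuclideanSpace ℝ (Fin 3) →L[ℝ] ℝ) (f := fderiv ℝ ζ)
      (fun x => ?_) (fun x hx => fderiv_of_notMem_tsupport ℝ (hout x hx))
    exact hC₁ R hR0 x
  have hI2 : ∫ x, ‖fderiv ℝ (fderiv ℝ ζ) x‖ ≤ C₃ / R ^ 2 * V2 := by
    refine integral_norm_le_of_le_of_support
      (F := EuclideanSpace ℝ (Fin 3) →L[ℝ] (EuclideanSpace ℝ (Fin 3) →L[ℝ] ℝ)) (f := fderiv ℝ (fderiv ℝ ζ))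
      (fun x => ?_) (fun x hx => ?_)
    · exact hC₃ R hR0 x
    · have hx' : x ∉ tsupport (fderiv ℝ ζ) := fun h' => hout x hx (tsupport_fderiv_subset ℝ h')
      exact fderiv_of_notMem_tsupport ℝ hx'
  have hIΔ : ∫ x, ‖(Δ ζ) x‖ ≤ C₂ / R ^ 2 * V2 := by
    refine integral_norm_le_of_le_of_support (fun x => ?_) (fun x hx => ?_)
    · rw [Real.norm_eq_abs]; exact hC₂ R hR0 x
    · exact FluidPDE.laplacian_eq_zero_of_notMem_tsupport (hout x hx)
  -- collect: every size is `≤ (const) · V2 / R` since `R ≥ 1`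
  have hR1 : 1 / R ^ 2 ≤ 1 / R := by
    rw [div_le_div_iff₀ (by positivity) hR0]; nlinarith
  have e1 : M * (∫ x, ‖(Δ ζ) x‖) ≤ M * C₂ * (V2 / R) := by
    have : C₂ / R ^ 2 * V2 ≤ C₂ * (V2 / R) := by
      have := mul_le_mul_of_nonneg_left hR1 (mul_nonneg hC₂0 hV20)
      calc C₂ / R ^ 2 * V2 = C₂ * V2 * (1 / R ^ 2) := by ring
        _ ≤ C₂ * V2 * (1 / R) := this
        _ = C₂ * (V2 / R) := by ring
    nlinarith [mul_le_mul_of_nonneg_left (hIΔ.trans this) hM0]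
  have e2 : (∫ x, ‖fderiv ℝ ζ x‖) ≤ C₁ * (V2 / R) := by
    calc (∫ x, ‖fderiv ℝ ζ x‖) ≤ C₁ / R * V2 := hI1
      _ = C₁ * (V2 / R) := by ring
  have e3 : κ * (2 * R) * (∫ x, ‖fderiv ℝ (fderiv ℝ ζ) x‖) ≤ κ * 2 * C₃ * (V2 / R) := by
    have h3 := mul_le_mul_of_nonneg_left hI2 (by positivity : 0 ≤ κ * (2 * R))
    calc κ * (2 * R) * (∫ x, ‖fderiv ℝ (fderiv ℝ ζ) x‖) ≤ κ * (2 * R) * (C₃ / R ^ 2 * V2) := h3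
      _ = κ * 2 * C₃ * (V2 / R) := by field_simp
  have e4 : (3 / 2 * κ + 8 * 64 * κ ^ 3) * (2 / R) * (∫ x, |ζ x|) ≤ (3 / 2 * κ + 8 * 64 * κ ^ 3) * 2 * (V2 / R) := by
    have h4 := mul_le_mul_of_nonneg_left hI0 (by positivity : 0 ≤ (3 / 2 * κ + 8 * 64 * κ ^ 3) * (2 / R))
    calc (3 / 2 * κ + 8 * 64 * κ ^ 3) * (2 / R) * (∫ x, |ζ x|)
        ≤ (3 / 2 * κ + 8 * 64 * κ ^ 3) * (2 / R) * (1 * V2) := h4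
      _ = (3 / 2 * κ + 8 * 64 * κ ^ 3) * 2 * (V2 / R) := by field_simp
  refine h.trans ?_
  have hes : 0 ≤ ‖e‖ * (s - s') := mul_nonneg (norm_nonneg _) (by linarith)
  have hsum : M * (∫ x, ‖(Δ ζ) x‖) + M ^ 2 * ((∫ x, ‖fderiv ℝ ζ x‖) +
      κ * (2 * R) * (∫ x, ‖fderiv ℝ (fderiv ℝ ζ) x‖) + (3 / 2 * κ + 8 * 64 * κ ^ 3) * (2 / R) * (∫ x, |ζ x|)) ≤
      (M * C₂ + M ^ 2 * (C₁ + κ * 2 * C₃ + (3 / 2 * κ + 8 * 64 * κ ^ 3) * 2)) * V2 / R := by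
    have hM2 : 0 ≤ M ^ 2 := sq_nonneg _
    have := add_le_add e1 (mul_le_mul_of_nonneg_left (add_le_add (add_le_add e2 e3) e4) hM2)
    refine this.trans (le_of_eq ?_)
    ring
  calc ‖e‖ * (s - s') * (M * (∫ x, ‖(Δ ζ) x‖) + M ^ 2 * ((∫ x, ‖fderiv ℝ ζ x‖) +
        κ * (2 * R) * (∫ x, ‖fderiv ℝ (fderiv ℝ ζ) x‖) + (3 / 2 * κ + 8 * 64 * κ ^ 3) * (2 / R) * (∫ x, |ζ x|)))
      ≤ ‖e‖ * (s - s') * ((M * C₂ + M ^ 2 * (C₁ + κ * 2 * C₃ + (3 / 2 * κ + 8 * 64 * κ ^ 3) * 2)) * V2 / R) :=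
        mul_le_mul_of_nonneg_left hsum hes

/-! ### two profiles whose slices differ by a constant -/

/-- The mass of the cut-off dominates the volume of the closed ball of radius `R`: `∫ cutoff R ≥ |B̄(0,R)|`. -/
theorem volume_real_closedBall_le_integral_cutoff {R : ℝ} (hR : 0 < R) :
    volume.real (closedBall (0 : EuclideanSpace ℝ (Fin 3)) R) ≤ ∫ x, cutoff (E := EuclideanSpace ℝ (Fin 3)) R x := by
  set ζ : EuclideanSpace ℝ (Fin 3) → ℝ := cutoff (E := EuclideanSpace ℝ (Fin 3)) R with hζ
  have hζc : Continuous ζ := (contDiff_cutoff (n := 0) R).continuous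
  have hζi : Integrable ζ := hζc.integrable_of_hasCompactSupport (hasCompactSupport_cutoff hR)
  have h1 : ∫ x in closedBall (0 : EuclideanSpace ℝ (Fin 3)) R, ζ x =
      ∫ x in closedBall (0 : EuclideanSpace ℝ (Fin 3)) R, (1 : ℝ) := by
    refine setIntegral_congr_fun measurableSet_closedBall fun x hx => ?_
    rw [mem_closedBall, dist_zero_right] at hx
    exact cutoff_eq_one hR hx
  have h2 : ∫ x in closedBall (0 : EuclideanSpace ℝ (Fin 3)) R, ζ x ≤ ∫ x, ζ x :=
    setIntegral_le_integral hζi (Eventually.of_forall fun x => cutoff_nonneg R x)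
  rw [h1, setIntegral_const, smul_eq_mul, mul_one] at h2
  exact h2

/-- **TWO PROFILES OF THE CLASS WHOSE SLICES AT ONE TIME DIFFER BY A CONSTANT VECTOR AGREE THERE** (the constant is
zero).  Proof: pair the difference with the cut-off `ζ_R`: `‖d‖² ∫ζ_R` equals a momentum defect of `w` on `[s', s]`,
plus a momentum defect of `v`, plus `∫ζ_R⟪w(s') − v(s'), d⟫`, which the Type-I rate bounds by `2‖d‖C|supp|/√(−s')`;
the defects are `O(|B̄_{2R}|/R)` (`exists_cutoff_momentum_defect_le`) and `∫ζ_R ≥ |B̄_R| = |B̄_{2R}|/8`; let `R → ∞`, then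
`s' → −∞`.  Equivalently: the LARGE-SCALE MEAN VELOCITY of a profile of the class is the same for all profiles of the
class on a given slice (namely zero). -/
theorem eq_zero_of_slice_sub_eq_const (hrate : HasTypeITimeDecay C v)
    (hcont : ContinuousOn (uncurry v) (Iio (0 : ℝ) ×ˢ univ))
    (hmild : ∀ s t : ℝ, s < t → t < 0 → ∀ y,
      v t y = heatExtension (v s) (t - s) y - oseenDuhamel 1 s v v t y)
    {w : ℝ → EuclideanSpace ℝ (Fin 3) → EuclideanSpace ℝ (Fin 3)} (hrate' : HasTypeITimeDecay C w)
    (hcont' : ContinuousOn (uncurry w) (Iio (0 : ℝ) ×ˢ univ))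
    (hmild' : ∀ s t : ℝ, s < t → t < 0 → ∀ y,
      w t y = heatExtension (w s) (t - s) y - oseenDuhamel 1 s w w t y)
    {s : ℝ} (hs : s < 0) {d : EuclideanSpace ℝ (Fin 3)} (hd : ∀ y, w s y - v s y = d) : d = 0 := by
  by_contra hd0
  have hδ : 0 < ‖d‖ := norm_pos_iff.2 hd0
  obtain ⟨Kv, hKv0, hKv⟩ := exists_cutoff_momentum_defect_le hrate hcont hmild hs
  obtain ⟨Kw, hKw0, hKw⟩ := exists_cutoff_momentum_defect_le hrate' hcont' hmild' hs
  have hC0 : 0 ≤ C := by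
    by_contra hC
    push Not at hC
    have h1 := div_neg_of_neg_of_pos hC (Real.sqrt_pos.2 (neg_pos.2 hs))
    linarith [(norm_nonneg (v s 0)).trans (hrate s hs 0)]
  -- ## the far-past time `s'`: `C/√(−s') ≤ ‖d‖/8`
  set s' : ℝ := min (s - 1) (-((8 * C / ‖d‖) ^ 2 + 1)) with hs'def
  have hs's : s' < s := lt_of_le_of_lt (min_le_left _ _) (by linarith)
  have hs'0 : s' < 0 := hs's.trans hs
  have hs'le : s' ≤ -((8 * C / ‖d‖) ^ 2 + 1) := min_le_right _ _
  have hsq : 8 * C / ‖d‖ ≤ Real.sqrt (-s') := by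
    have h1 : (8 * C / ‖d‖) ^ 2 ≤ -s' := by linarith
    calc 8 * C / ‖d‖ = Real.sqrt ((8 * C / ‖d‖) ^ 2) := (Real.sqrt_sq (by positivity)).symm
      _ ≤ Real.sqrt (-s') := Real.sqrt_le_sqrt h1
  have hrate_s' : C / Real.sqrt (-s') ≤ ‖d‖ / 8 := by
    have hsq0 : 0 < Real.sqrt (-s') := Real.sqrt_pos.2 (neg_pos.2 hs'0)
    rw [div_le_iff₀ hsq0]
    have := mul_le_mul_of_nonneg_left hsq (by positivity : 0 ≤ ‖d‖ / 8)
    calc C = ‖d‖ / 8 * (8 * C / ‖d‖) := by field_simp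
      _ ≤ ‖d‖ / 8 * Real.sqrt (-s') := this
  -- ## the large radius `R`
  set R : ℝ := 16 * (s - s') * (Kv + Kw) / ‖d‖ + 1 with hRdef
  have hss' : 0 < s - s' := by linarith
  have hR1 : 1 ≤ R := by
    rw [hRdef]
    have : 0 ≤ 16 * (s - s') * (Kv + Kw) / ‖d‖ := by positivity
    linarith
  have hR0 : 0 < R := by linarith
  have hRK : 8 * (s - s') * (Kv + Kw) / R ≤ ‖d‖ / 2 := by
    rw [div_le_iff₀ hR0, hRdef]
    have h1 : ‖d‖ / 2 * (16 * (s - s') * (Kv + Kw) / ‖d‖ + 1) = 8 * (s - s') * (Kv + Kw) + ‖d‖ / 2 := by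
      field_simp
      ring
    rw [h1]
    linarith
  -- ## volumes and the cut-off
  set ζ : EuclideanSpace ℝ (Fin 3) → ℝ := cutoff (E := EuclideanSpace ℝ (Fin 3)) R with hζ
  set V1 : ℝ := volume.real (closedBall (0 : EuclideanSpace ℝ (Fin 3)) R) with hV1
  set V2 : ℝ := volume.real (closedBall (0 : EuclideanSpace ℝ (Fin 3)) (2 * R)) with hV2
  have hV21 : V2 = 8 * V1 := by
    rw [hV2, hV1, measureReal_def, measureReal_def]
    exact volume_closedBall_two_mul hR0.le
  have hV1pos : 0 < V1 := by
    rw [hV1, measureReal_def]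
    exact ENNReal.toReal_pos (measure_closedBall_pos volume _ hR0).ne' measure_closedBall_lt_top.ne
  have hζV1 : V1 ≤ ∫ x, ζ x := volume_real_closedBall_le_integral_cutoff hR0
  have hζpos : 0 < ∫ x, ζ x := lt_of_lt_of_le hV1pos hζV1
  -- ## continuity / integrability of the paired slices
  have hζc : Continuous ζ := (contDiff_cutoff (n := 0) R).continuous
  have hζcs : HasCompactSupport ζ := hasCompactSupport_cutoff hR0
  have hvs : Continuous (v s) := continuous_slice hcont hs
  have hvs' : Continuous (v s') := continuous_slice hcont hs'0
  have hws : Continuous (w s) := continuous_slice hcont' hs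
  have hws' : Continuous (w s') := continuous_slice hcont' hs'0
  have hint : ∀ {f : EuclideanSpace ℝ (Fin 3) → EuclideanSpace ℝ (Fin 3)}, Continuous f →
      Integrable fun x => ζ x * ⟪f x, d⟫ := fun hf =>
    (hζc.mul (hf.inner continuous_const)).integrable_of_hasCompactSupport hζcs.mul_right
  -- ## the identity `‖d‖² ∫ζ = defect(w) + middle + defect(v)`
  have hsplit : ∀ x, ζ x * ⟪w s x - v s x, d⟫ =
      ζ x * ⟪w s x - w s' x, d⟫ + ζ x * ⟪w s' x - v s' x, d⟫ + ζ x * ⟪v s' x - v s x, d⟫ := by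
    intro x
    simp only [inner_sub_left]
    ring
  have hlhs : ∫ x, ζ x * ⟪w s x - v s x, d⟫ = ‖d‖ ^ 2 * ∫ x, ζ x := by
    have : (fun x => ζ x * ⟪w s x - v s x, d⟫) = fun x => ‖d‖ ^ 2 * ζ x := by
      funext x; rw [hd x, real_inner_self_eq_norm_sq]; ring
    rw [this, integral_const_mul]
  have i1 : Integrable fun x => ζ x * ⟪w s x - w s' x, d⟫ := hint (hws.sub hws')
  have i2 : Integrable fun x => ζ x * ⟪w s' x - v s' x, d⟫ := hint (hws'.sub hvs')
  have i3 : Integrable fun x => ζ x * ⟪v s' x - v s x, d⟫ := hint (hvs'.sub hvs)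
  have hI : ∫ x, ζ x * ⟪w s x - v s x, d⟫ =
      (∫ x, ζ x * ⟪w s x - w s' x, d⟫) + (∫ x, ζ x * ⟪w s' x - v s' x, d⟫) +
        ∫ x, ζ x * ⟪v s' x - v s x, d⟫ := by
    have i12 : Integrable fun x => ζ x * ⟪w s x - w s' x, d⟫ + ζ x * ⟪w s' x - v s' x, d⟫ := i1.add i2
    have e : (fun x => ζ x * ⟪w s x - v s x, d⟫) =
        fun x => (ζ x * ⟪w s x - w s' x, d⟫ + ζ x * ⟪w s' x - v s' x, d⟫) + ζ x * ⟪v s' x - v s x, d⟫ :=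
      funext hsplit
    rw [e, integral_add i12 i3, integral_add i1 i2]
  -- ## the three bounds
  have hB1 : |∫ x, ζ x * ⟪w s x - w s' x, d⟫| ≤ ‖d‖ * (s - s') * (Kw * V2 / R) := hKw s' hs's R hR1 d
  have hB3 : |∫ x, ζ x * ⟪v s' x - v s x, d⟫| ≤ ‖d‖ * (s - s') * (Kv * V2 / R) := by
    have h := hKv s' hs's R hR1 d
    have e : (fun x => ζ x * ⟪v s' x - v s x, d⟫) = fun x => -(ζ x * ⟪v s x - v s' x, d⟫) := by
      funext x; rw [← neg_sub, inner_neg_left]; ring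
    rw [e, integral_neg, abs_neg]
    exact h
  have hB2 : |∫ x, ζ x * ⟪w s' x - v s' x, d⟫| ≤ ‖d‖ ^ 2 / 4 * ∫ x, ζ x := by
    have hpt : ∀ x, |ζ x * ⟪w s' x - v s' x, d⟫| ≤ ‖d‖ ^ 2 / 4 * ζ x := by
      intro x
      rw [abs_mul, abs_of_nonneg (cutoff_nonneg R x)]
      have h1 : |⟪w s' x - v s' x, d⟫| ≤ ‖w s' x - v s' x‖ * ‖d‖ := abs_real_inner_le_norm _ _
      have h2 : ‖w s' x - v s' x‖ ≤ C / Real.sqrt (-s') + C / Real.sqrt (-s') :=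
        (norm_sub_le _ _).trans (add_le_add (hrate' s' hs'0 x) (hrate s' hs'0 x))
      have h3 : ‖w s' x - v s' x‖ * ‖d‖ ≤ (‖d‖ / 8 + ‖d‖ / 8) * ‖d‖ :=
        mul_le_mul_of_nonneg_right (h2.trans (add_le_add hrate_s' hrate_s')) (norm_nonneg _)
      have h4 : |⟪w s' x - v s' x, d⟫| ≤ ‖d‖ ^ 2 / 4 := by nlinarith
      calc ζ x * |⟪w s' x - v s' x, d⟫| ≤ ζ x * (‖d‖ ^ 2 / 4) :=
            mul_le_mul_of_nonneg_left h4 (cutoff_nonneg R x)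
        _ = ‖d‖ ^ 2 / 4 * ζ x := by ring
    calc |∫ x, ζ x * ⟪w s' x - v s' x, d⟫| ≤ ∫ x, |ζ x * ⟪w s' x - v s' x, d⟫| := abs_integral_le_integral_abs
      _ ≤ ∫ x, ‖d‖ ^ 2 / 4 * ζ x :=
          integral_mono (hint (hws'.sub hvs')).abs ((hζc.integrable_of_hasCompactSupport hζcs).const_mul _) hpt
      _ = ‖d‖ ^ 2 / 4 * ∫ x, ζ x := integral_const_mul _ _
  -- ## assemble: `(3/4)‖d‖² ∫ζ ≤ ‖d‖ (s−s') (Kv+Kw) V2/R ≤ ‖d‖ · (‖d‖/2) · ∫ζ`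
  have hmain : ‖d‖ ^ 2 * (∫ x, ζ x) ≤
      ‖d‖ * (s - s') * (Kw * V2 / R) + ‖d‖ ^ 2 / 4 * (∫ x, ζ x) + ‖d‖ * (s - s') * (Kv * V2 / R) := by
    have h1 : ‖d‖ ^ 2 * (∫ x, ζ x) = (∫ x, ζ x * ⟪w s x - w s' x, d⟫) +
        (∫ x, ζ x * ⟪w s' x - v s' x, d⟫) + ∫ x, ζ x * ⟪v s' x - v s x, d⟫ := by rw [← hlhs, hI]
    have h := le_abs_self ((∫ x, ζ x * ⟪w s x - w s' x, d⟫) +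
        (∫ x, ζ x * ⟪w s' x - v s' x, d⟫) + ∫ x, ζ x * ⟪v s' x - v s x, d⟫)
    have h' := (abs_add_le _ _).trans (add_le_add ((abs_add_le _ _).trans (add_le_add hB1 hB2)) hB3)
    linarith
  have hV2ζ : V2 ≤ 8 * ∫ x, ζ x := by rw [hV21]; linarith
  have hdef : ‖d‖ * (s - s') * (Kw * V2 / R) + ‖d‖ * (s - s') * (Kv * V2 / R) ≤
      ‖d‖ * (‖d‖ / 2) * ∫ x, ζ x := by
    have h1 : ‖d‖ * (s - s') * (Kw * V2 / R) + ‖d‖ * (s - s') * (Kv * V2 / R) =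
        ‖d‖ * ((s - s') * (Kv + Kw) / R) * V2 := by ring
    rw [h1]
    have h2 : ‖d‖ * ((s - s') * (Kv + Kw) / R) * V2 ≤ ‖d‖ * ((s - s') * (Kv + Kw) / R) * (8 * ∫ x, ζ x) :=
      mul_le_mul_of_nonneg_left hV2ζ (by positivity)
    refine h2.trans ?_
    have h3 : ‖d‖ * ((s - s') * (Kv + Kw) / R) * (8 * ∫ x, ζ x) =
        ‖d‖ * (8 * (s - s') * (Kv + Kw) / R) * ∫ x, ζ x := by ring
    rw [h3]
    exact mul_le_mul_of_nonneg_right (mul_le_mul_of_nonneg_left hRK hδ.le) hζpos.le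
  have hfin : ‖d‖ ^ 2 * (∫ x, ζ x) ≤ ‖d‖ ^ 2 / 4 * (∫ x, ζ x) + ‖d‖ * (‖d‖ / 2) * ∫ x, ζ x := by linarith
  have : ‖d‖ ^ 2 * (∫ x, ζ x) / 4 ≤ 0 := by nlinarith
  have hpos : 0 < ‖d‖ ^ 2 * (∫ x, ζ x) / 4 := by positivity
  linarith

end Summit.NavierStokesRegularity.NavierStokesRegularity.Theorems.PoloidalWindowDoorPoloidalWindowRigidityZeroMeanMomentum

end
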